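import Summits.QuantumFields.YangMills.Theorems.VirialFluxGapTwistEaterQuaternion
import Summits.QuantumFields.YangMills.Theorems.VirialFluxGapTwistEaterConjugacy
import Summits.QuantumFields.YangMills.Theorems.TwistEaterVolumeQuadraticGrowthRing
import HarnessLib

/-!
# SU(2) twist-eaters are conjugate to a sign class of a fixed reference pair
# (layer (B1b) closure, group level, of the DIRECT Laplace road to ⟨stmt-QuantumFields-24204⟩ `VirialFluxGap.SharpTwistedLaplace`)

Helper module (free-hands work of width seat ym-line-sfw-p2-w2 g49, cell ym-idea-1).  ★ `exists_conj_signClass_of_twistEater` — in `SU(2)`: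
commuting `w_k` and `c` with `c w_k c⁻¹ = centreElem(z_k) w_k` (`z ≠ 0`), and ANY reference pair `(N₀, C₀)` of trace-free elements with
orthogonal quaternion axes: there are signs `s` and `g₀ ∈ SU(2)` with `g₀ w_k g₀⁻¹ = centreElem(s_k) · (N₀ if z_k else 1)` and `g₀ c g₀⁻¹ = C₀`
(✓`twistEater_structure` + ✓`exists_unit_conj_pair_eq`, transported along `su2Quat`).  With ✓`exists_combGauge_of_ringDeficit_eq_zero` and a
constant gauge transformation this exhibits the zero set of the twisted ring deficit as the union of the `2³` (= 4 distinct) gauge orbits of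
the sign-class rings.  Everything here is PROVED; no definitions, no named facts.  HONEST FRAMING: algebra; ⟨24204⟩, ⟨24319⟩ and every rung
stay OPEN; the Yang–Mills mass gap (Clay) is NOT touched; no summit is proved by a line.
-/

set_option autoImplicit false

noncomputable section

open scoped Quaternion
open Literature.MathematicalPhysics.QuantumLattice
open Literature.MathematicalPhysics.QuantumFieldTheory.Balaban1983to89.T4WilsonGaugeFlatDirection (su2Quat_injective)
open Literature.MathematicalPhysics.QuantumFieldTheory.Balaban1983to89.T4HaarSU2Translate (su2Quat_mul)
open Summit.QuantumFields.YangMills.Theorems.FemtoTransferGap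
open Summit.QuantumFields.YangMills.Theorems.FemtoTransferGap.TT
open Summit.QuantumFields.YangMills.Theorems.ToronValleyVolume.Lojasiewicz
open Summit.QuantumFields.YangMills.Theorems.TwistEaterVolume.Quadratic

namespace Summit.QuantumFields.YangMills.Theorems.QuantitativeLaplace

/-- `su2Quat` of a centre element: `±1`. [folklore] -/
theorem su2Quat_centreElem (b : Bool) : su2Quat (centreElem b) = if b then (-1 : ℍ) else 1 := by
  cases b
  · simp [centreElem, su2Quat_one]
  · simp [centreElem, su2Quat_negOne]

/-- ★ **Twist-eaters are conjugate to a sign class of a reference pair.** [cite: GonzalezarroyoAltes1988, §2] -/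
theorem exists_conj_signClass_of_twistEater (z : Fin 3 → Bool) (hz : z ≠ fun _ => false)
    {w : Fin 3 → SU2} {c : SU2} (hww : ∀ i j, w i * w j = w j * w i) (hcw : ∀ k, c * w k * c⁻¹ = centreElem (z k) * w k)
    {N₀ C₀ : SU2} (hN : (su2Quat N₀).re = 0) (hC : (su2Quat C₀).re = 0)
    (hNC : (su2Quat N₀).imI * (su2Quat C₀).imI + (su2Quat N₀).imJ * (su2Quat C₀).imJ + (su2Quat N₀).imK * (su2Quat C₀).imK = 0) :
    ∃ (s : Fin 3 → Bool) (g₀ : SU2),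
      (∀ k, g₀ * w k * g₀⁻¹ = centreElem (s k) * (if z k then N₀ else 1)) ∧ g₀ * c * g₀⁻¹ = C₀ := by
  classical
  obtain ⟨k₀, hk₀⟩ : ∃ k₀, z k₀ = true := by
    by_contra hcon
    push Not at hcon
    exact hz (funext fun k => by simpa using hcon k)
  -- quaternion data
  set a : ℍ := su2Quat c with ha
  set u : Fin 3 → ℍ := fun k => su2Quat (w k) with hu
  have ha1 : ‖a‖ = 1 := norm_su2Quat c
  have hu1 : ∀ k, ‖u k‖ = 1 := fun k => norm_su2Quat (w k)
  have hcomm : ∀ i j, u i * u j = u j * u i := fun i j => by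
    simp only [hu]; rw [← su2Quat_mul, ← su2Quat_mul, hww]
  have hrel : ∀ k, a * u k = (if z k then (-1 : ℍ) else 1) * u k * a := fun k => by
    have h := hcw k
    rw [mul_inv_eq_iff_eq_mul] at h
    have := congrArg su2Quat h
    rw [su2Quat_mul, su2Quat_mul, su2Quat_mul, su2Quat_centreElem] at this
    simpa only [ha, hu] using this
  have htw : ∀ k, z k = true → a * u k = -(u k * a) := fun k hk => by
    rw [hrel k, if_pos hk]; simp
  have hun : ∀ k, z k = false → a * u k = u k * a := fun k hk => by
    rw [hrel k, hk]; simp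
  obtain ⟨hare, hu0re, hperp, htwist, huntw⟩ := twistEater_structure a u z k₀ hk₀ ha1 hu1 hcomm htw hun
  -- conjugate `(u k₀, a)` to the reference pair
  have hperp' : (u k₀).imI * a.imI + (u k₀).imJ * a.imJ + (u k₀).imK * a.imK = 0 := by linarith [hperp]
  obtain ⟨v, hv1, hvn, hva⟩ := exists_unit_conj_pair_eq (hu1 k₀) hu0re ha1 hare hperp'
    (norm_su2Quat N₀) hN (norm_su2Quat C₀) hC hNC
  have hv0 : v ≠ 0 := by intro h; rw [h, norm_zero] at hv1; exact zero_ne_one hv1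
  obtain ⟨Y, hY, -⟩ := exists_su2_family_of_unit_quaternions (fun _ : Unit => v) (fun _ => hv1)
  set g₀ : SU2 := Y () with hg₀
  have hg₀q : su2Quat g₀ = v := hY ()
  have hg₀inv : su2Quat g₀⁻¹ = v⁻¹ := by
    have h : su2Quat g₀ * su2Quat g₀⁻¹ = 1 := by rw [← su2Quat_mul, mul_inv_cancel, su2Quat_one]
    rw [← hg₀q]; exact eq_inv_of_mul_eq_one_right h
  -- the sign pattern
  refine ⟨fun k => if z k then decide (u k = -(u k₀)) else decide (u k = -1), g₀, fun k => ?_, ?_⟩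
  · apply su2Quat_injective
    rw [su2Quat_mul, su2Quat_mul, hg₀q, hg₀inv, su2Quat_mul, su2Quat_centreElem]
    by_cases hk : z k = true
    · simp only [hk, if_true]
      rcases htwist k hk with h | h
      · have hd : decide (u k = -(u k₀)) = false := by
          rw [decide_eq_false_iff_not]; intro h'
          have : u k₀ = 0 := by
            have e : u k₀ = -(u k₀) := h.symm.trans h'
            have e2 : (2 : ℝ) • u k₀ = 0 := by rw [two_smul]; nth_rewrite 2 [e]; exact add_neg_cancel _
            exact (smul_eq_zero.mp e2).resolve_left (by norm_num)
          have := hu1 k₀; rw [‹u k₀ = 0›, norm_zero] at this; exact zero_ne_one this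
        rw [hd]; simp only [Bool.false_eq_true, if_false, one_mul]
        show v * su2Quat (w k) * v⁻¹ = su2Quat N₀
        rw [show su2Quat (w k) = u k from rfl, h, hvn]
      · have hd : decide (u k = -(u k₀)) = true := by rw [decide_eq_true_iff]; exact h
        rw [hd]; simp only [if_true]
        show v * su2Quat (w k) * v⁻¹ = -1 * su2Quat N₀
        rw [show su2Quat (w k) = u k from rfl, h, ← hvn]; simp [mul_assoc]
    · have hk' : z k = false := by simpa using hk
      simp only [hk', Bool.false_eq_true, if_false, su2Quat_one]
      rcases huntw k hk' with h | h
      · have hd : decide (u k = -1) = false := by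
          rw [decide_eq_false_iff_not]; intro h'; rw [h] at h'
          have hre := congrArg QuaternionAlgebra.re h'
          norm_num at hre
        rw [hd]; simp only [Bool.false_eq_true, if_false, one_mul]
        show v * su2Quat (w k) * v⁻¹ = 1
        rw [show su2Quat (w k) = u k from rfl, h, mul_one, mul_inv_cancel₀ hv0]
      · have hd : decide (u k = -1) = true := by rw [decide_eq_true_iff]; exact h
        rw [hd]; simp only [if_true, mul_one]
        show v * su2Quat (w k) * v⁻¹ = -1
        rw [show su2Quat (w k) = u k from rfl, h]; simp [mul_inv_cancel₀ hv0]
  · apply su2Quat_injective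
    rw [su2Quat_mul, su2Quat_mul, hg₀q, hg₀inv, ← ha, hva]

end Summit.QuantumFields.YangMills.Theorems.QuantitativeLaplace
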